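import Mathlib
import Summits.RiemannHypothesis.RiemannHypothesis.Theorems.WeilFarCoercivityFloor
import Summits.RiemannHypothesis.RiemannHypothesis.Theorems.WeilFarFloorKappaRoot
import HarnessLib

/-!
# The floor law's main term to `O(1)`: `pntFloor a ≤ e^a + 2a` (`a ≥ 4`)

Helper file (`--supports stmt-RiemannHypothesis-0098`, lead-track anchor: Weil-positivity window ladder, format-C far bound),
RH-free, pure proofs.  Seat rh-explicit-weil-1 gen9 (memo `run/shared/lean/pub/rh-explicit/rh-explicit-weil-1/FORMAT-K3.md` §10.5).
`WeilFarCoercivityFloor` defines the PNT-kernel eigenvalue `L(a) = pntFloor a = 1/(κ² − ¼)`, `κ = pntKappa a` the root of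
`κ tanh κa = ½` (`WeilFarFloorKappaRoot`), and `WeilFarFloorOrder` proves `e^a ≤ L(a) ≤ e^a + 4a`.  With `δ = κ − ½` one has EXACTLY
`L = 1/(δ(1 + δ))` and `δ·e^a·e^{2δa} = 1 + δ`; here the second-order bookkeeping (`e^{−x} ≥ 1 − x`, `e^x ≤ 1 + x + x²`,
`x = 2δa ≤ 1/(a + 1)` from `e^a ≥ 2.314·a(a + 1)` for `a ≥ 4`) gives **`pntFloor a ≤ e^a + 2a` for `a ≥ 4`** (`pntFloor_le_exp_add_two_mul`;
numerically `L(a) = e^a + 2a − 2 + o(1)`: `−2.36` at `a = 4`, `−2.14` at `6`, `−2.0` at `10`).  So the law C-XIII reads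
`λ_max(a) = e^a + 2a − 2 − 2γ_E + o(1) + ε(a)`, and the RH-conditional lower bound `e^a + 2a − K ≤ λ_max(a)` of `WeilFarFloorCoshTestRH`
becomes the lower clause `pntFloor a − K ≤ λ_max(a)`.  Standard axioms only.
-/

set_option linter.dupNamespace false
set_option autoImplicit false

noncomputable section

open Set
open scoped Real

namespace Summit.RiemannHypothesis.RiemannHypothesis.Theorems.WeilFormatC

namespace FloorGrowth

variable {a : ℝ}

/-- `e^a ≥ 2.314·a·(a + 1)` for `a ≥ 4`. -/
theorem exp_ge_quad_four (ha : 4 ≤ a) : 2314 / 1000 * (a * (a + 1)) ≤ Real.exp a := by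
  have h1 := Real.exp_one_gt_d9
  have he0 : 0 < Real.exp 1 := Real.exp_pos 1
  have hsq : (738 : ℝ) / 100 ≤ Real.exp 1 * Real.exp 1 := by nlinarith
  have h4 : (54 : ℝ) ≤ Real.exp 4 := by
    rw [show (4 : ℝ) = (1 + 1) + (1 + 1) by norm_num, Real.exp_add, Real.exp_add]
    calc (54 : ℝ) ≤ 738 / 100 * (738 / 100) := by norm_num
      _ ≤ _ := mul_le_mul hsq hsq (by norm_num) (by positivity)
  have hq : 1 + (a - 4) + (a - 4) ^ 2 / 2 ≤ Real.exp (a - 4) := Real.quadratic_le_exp_of_nonneg (by linarith)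
  have hsplit : Real.exp a = Real.exp 4 * Real.exp (a - 4) := by rw [← Real.exp_add]; ring_nf
  have hc : 0 ≤ 1 + (a - 4) + (a - 4) ^ 2 / 2 := by have := sq_nonneg (a - 4); linarith
  have hprod : 54 * (1 + (a - 4) + (a - 4) ^ 2 / 2) ≤ Real.exp 4 * Real.exp (a - 4) :=
    mul_le_mul h4 hq hc (Real.exp_pos 4).le
  have hu : 0 ≤ a - 4 := by linarith
  have key : 2314 / 1000 * (a * (a + 1)) ≤ 54 * (1 + (a - 4) + (a - 4) ^ 2 / 2) := by
    nlinarith [sq_nonneg (a - 4), hu]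
  rw [hsplit]
  exact key.trans hprod

/-- Arithmetic step: `x(a+1) ≤ 1 ⇒ 2a(1+δ)x ≤ 2(1+δ)(1−x)`. -/
theorem aux_h5 {a δ x : ℝ} (hδ : 0 ≤ 1 + δ) (h : x * (a + 1) ≤ 1) :
    2 * a * (1 + δ) * x ≤ 2 * (1 + δ) * (1 - x) := by
  nlinarith [mul_le_mul_of_nonneg_left h hδ]

/-- Arithmetic step: the final chain of the sharp bound. -/
theorem aux_chain {E X P x δ a : ℝ} (hA1 : E * X ≤ E + P * (1 + x)) (h4 : P * (1 + x) ≤ 2 * a * (1 + δ) * (1 + x))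
    (h5 : 2 * a * (1 + δ) * x ≤ 2 * (1 + δ) * (1 - x)) (hge : (1 + δ) * (1 - x) ≤ δ * E)
    (h2 : (E + 2 * a) * (1 + 2 * δ) ≤ (E + 2 * a) * (1 + δ) ^ 2) (haδ : 0 ≤ a * δ) :
    E * X ≤ (E + 2 * a) * (1 + δ) ^ 2 := by
  nlinarith [hA1, h4, h5, hge, h2, haδ]

/-- **Sharp upper bound for the PNT-kernel eigenvalue**: for `κ > ½` with `κ sinh κa = cosh(κa)/2` and `a ≥ 4`,
`1/(κ² − ¼) ≤ e^a + 2a`. -/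
theorem inv_kappa_sq_sub_quarter_le_sharp {κ : ℝ} (ha : 4 ≤ a) (hκ : 1 / 2 < κ)
    (heig : κ * Real.sinh (κ * a) = Real.cosh (κ * a) / 2) :
    1 / (κ ^ 2 - 1 / 4) ≤ Real.exp a + 2 * a := by
  rw [inv_kappa_sq_sub_quarter_eq hκ heig]
  have h := kappa_sub_half_eq heig
  set δ := κ - 1 / 2 with hδ
  set q := Real.exp (-(2 * (κ * a))) with hq
  have hδpos : 0 < δ := by rw [hδ]; linarith
  have hk : κ + 1 / 2 = 1 + δ := by rw [hδ]; ring
  rw [hk] at h ⊢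
  have ha0 : 0 < a := by linarith
  -- q ≤ e^{−a} ≤ e^{−4}
  have hqa : q ≤ Real.exp (-a) := Real.exp_le_exp.2 (by nlinarith)
  have hea : Real.exp (-a) ≤ Real.exp (-2) := Real.exp_le_exp.2 (by linarith)
  have he2 : Real.exp (-2) ≤ 1354 / 10000 := by
    have : Real.exp (-2) = Real.exp (-1) ^ 2 := by rw [← Real.exp_nat_mul]; norm_num
    rw [this]; nlinarith [Real.exp_neg_one_lt_d9, Real.exp_pos (-1 : ℝ)]
  have hq0 : 0 < q := Real.exp_pos _
  have hδq : δ ≤ (1157 / 1000) * q := by nlinarith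
  -- x := 2δa
  set x := 2 * δ * a with hx
  have hx0 : 0 ≤ x := by positivity
  have hEpos : 0 < Real.exp a := Real.exp_pos a
  have hEinv : Real.exp a * Real.exp (-a) = 1 := by rw [← Real.exp_add]; simp
  -- the exact relation `δ e^a e^x = 1 + δ`
  have hsplit : Real.exp (2 * (κ * a)) = Real.exp a * Real.exp x := by
    rw [← Real.exp_add]; congr 1; rw [hx, hδ]; ring
  have hqE : q * (Real.exp a * Real.exp x) = 1 := by
    rw [← hsplit, hq, ← Real.exp_add]; simp
  have hkey : δ * Real.exp a = (1 + δ) * Real.exp (-x) := by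
    have hEx : Real.exp x * Real.exp (-x) = 1 := by rw [← Real.exp_add]; simp
    calc δ * Real.exp a = (1 + δ) * q * Real.exp a := by rw [← h]
      _ = (1 + δ) * q * Real.exp a * (Real.exp x * Real.exp (-x)) := by rw [hEx, mul_one]
      _ = (1 + δ) * (q * (Real.exp a * Real.exp x)) * Real.exp (-x) := by ring
      _ = (1 + δ) * Real.exp (-x) := by rw [hqE, mul_one]
  -- x ≤ 1/(a+1)
  have hxsmall : x * (a + 1) ≤ 1 := by
    have hxE : Real.exp a * x ≤ (2314 / 1000) * a := by
      have h1 : Real.exp a * δ ≤ Real.exp a * ((1157 / 1000) * q) := mul_le_mul_of_nonneg_left hδq hEpos.le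
      have h2 : Real.exp a * q ≤ Real.exp a * Real.exp (-a) := mul_le_mul_of_nonneg_left hqa hEpos.le
      rw [hEinv] at h2
      rw [hx]; nlinarith
    have hq4 := exp_ge_quad_four ha
    -- x (a+1) e^a ≤ 2.314 a (a+1) ≤ e^a
    have : x * (a + 1) * Real.exp a ≤ 1 * Real.exp a :=
      calc x * (a + 1) * Real.exp a = (Real.exp a * x) * (a + 1) := by ring
        _ ≤ (2314 / 1000) * a * (a + 1) := mul_le_mul_of_nonneg_right hxE (by linarith)
        _ = 2314 / 1000 * (a * (a + 1)) := by ring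
        _ ≤ Real.exp a := hq4
        _ = 1 * Real.exp a := (one_mul _).symm
    exact le_of_mul_le_mul_right this hEpos
  have hx1 : x ≤ 1 := by nlinarith
  -- e^x ≤ 1 + x + x², e^{−x} ≥ 1 − x
  have hexp : Real.exp x ≤ 1 + x + x ^ 2 := by
    have := Real.abs_exp_sub_one_sub_id_le (x := x) (by rw [abs_of_nonneg hx0]; exact hx1)
    have := (abs_le.1 this).2
    linarith
  have hexpneg : 1 - x ≤ Real.exp (-x) := by
    have := Real.add_one_le_exp (-x); linarith
  -- e^a x = 2a (δ e^a) ≤ 2a(1 + δ);  δ e^a ≥ (1 + δ)(1 − x)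
  have hδE_le : δ * Real.exp a ≤ 1 + δ := by
    rw [hkey]
    have : Real.exp (-x) ≤ 1 := by rw [Real.exp_le_one_iff]; linarith
    nlinarith
  have hδE_ge : (1 + δ) * (1 - x) ≤ δ * Real.exp a := by
    rw [hkey]; exact mul_le_mul_of_nonneg_left hexpneg (by linarith)
  have hEx : Real.exp a * x = 2 * a * (δ * Real.exp a) := by rw [hx]; ring
  -- main chain: e^a e^x ≤ e^a (1 + x + x²) ≤ (e^a + 2a)(1 + δ)²
  rw [hsplit, div_le_iff₀ (by positivity)]
  have h1 : Real.exp a * Real.exp x ≤ Real.exp a * (1 + x + x ^ 2) := mul_le_mul_of_nonneg_left hexp hEpos.le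
  have hsq : 1 + 2 * δ ≤ (1 + δ) ^ 2 := by nlinarith
  have hpos : 0 ≤ Real.exp a + 2 * a := by positivity
  have h2 : (Real.exp a + 2 * a) * (1 + 2 * δ) ≤ (Real.exp a + 2 * a) * (1 + δ) ^ 2 :=
    mul_le_mul_of_nonneg_left hsq hpos
  -- e^a(1 + x + x²) = e^a + (e^a x)(1 + x) ≤ e^a + 2a(1+δ)(1 + x) and 2δ e^a ≥ 2(1+δ)(1−x)
  have h3 : Real.exp a * (1 + x + x ^ 2) = Real.exp a + (Real.exp a * x) * (1 + x) := by ring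
  have h4 : (Real.exp a * x) * (1 + x) ≤ 2 * a * (1 + δ) * (1 + x) := by
    rw [hEx]
    have : 2 * a * (δ * Real.exp a) ≤ 2 * a * (1 + δ) := mul_le_mul_of_nonneg_left hδE_le (by linarith)
    exact mul_le_mul_of_nonneg_right this (by linarith)
  -- need: e^a + 2a(1+δ)(1+x) ≤ (e^a + 2a)(1 + 2δ) = e^a + 2δe^a + 2a + 4aδ, i.e. 2a(1+δ)x ≤ 2δe^a + 2aδ;
  -- and 2δe^a ≥ 2(1+δ)(1−x), so it suffices that 2a(1+δ)x ≤ 2(1+δ)(1−x), i.e. x(a+1) ≤ 1.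
  have h5 : 2 * a * (1 + δ) * x ≤ 2 * (1 + δ) * (1 - x) := aux_h5 (by linarith) hxsmall
  have A1 : Real.exp a * Real.exp x ≤ Real.exp a + (Real.exp a * x) * (1 + x) := by linarith [h1, h3]
  have A6 : 0 ≤ a * δ := by positivity
  exact aux_chain A1 h4 h5 hδE_ge h2 A6

/-- **`pntFloor a ≤ e^a + 2a` for `a ≥ 4`** (the floor law's main term `L(a)`, `WeilFarCoercivityFloor`). -/
theorem pntFloor_le_exp_add_two_mul (ha : 4 ≤ a) : pntFloor a ≤ Real.exp a + 2 * a := by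
  obtain ⟨hκ, heig⟩ := sInf_pntKappaSet_spec (by linarith : 0 < a)
  unfold pntFloor pntKappa
  exact inv_kappa_sq_sub_quarter_le_sharp ha hκ heig

end FloorGrowth

end Summit.RiemannHypothesis.RiemannHypothesis.Theorems.WeilFormatC

/-! ## Appendix (rh-explicit-weil-1 gen9, same day): the matching LOWER bound `e^a + 2a − 4 ≤ pntFloor a` (`a ≥ 4`)

With `WeilFarFloorOrder`'s `e^a ≤ L(a)` this makes the law's main term two-sided to `O(1)` in the kernel:
`e^a + 2a − 4 ≤ L(a) ≤ e^a + 2a` for `a ≥ 4` (numerically `L(a) − e^a − 2a → −2`).  Same bookkeeping as above, from below: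
`e^x ≥ 1 + x`, `δe^a ≥ (1+δ)(1−x)`, `δe^a ≤ 1 + δ`, `x = 2δa`, `a·x ≤ 2.314a²e^{−a} ≤ 0.69`, `aδ ≤ 0.0875`. -/

namespace Summit.RiemannHypothesis.RiemannHypothesis.Theorems.WeilFormatC

namespace FloorGrowth

variable {a : ℝ}

/-- Polynomial-versus-exponential bounds used below: `2.314·a² ≤ 0.69·e^a` and `4.63·a ≤ 0.35·e^a` for `a ≥ 4`. -/
theorem poly_le_exp_four (ha : 4 ≤ a) : 2314 / 1000 * a ^ 2 ≤ 69 / 100 * Real.exp a ∧ 463 / 100 * a ≤ 35 / 100 * Real.exp a := by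
  have hq := exp_ge_quad_four ha
  have h1 := Real.exp_one_gt_d9
  have he0 : 0 < Real.exp 1 := Real.exp_pos 1
  have hsq : (738 : ℝ) / 100 ≤ Real.exp 1 * Real.exp 1 := by nlinarith
  have h4 : (54 : ℝ) ≤ Real.exp 4 := by
    rw [show (4 : ℝ) = (1 + 1) + (1 + 1) by norm_num, Real.exp_add, Real.exp_add]
    calc (54 : ℝ) ≤ 738 / 100 * (738 / 100) := by norm_num
      _ ≤ _ := mul_le_mul hsq hsq (by norm_num) (by positivity)
  have hquad : 1 + (a - 4) + (a - 4) ^ 2 / 2 ≤ Real.exp (a - 4) := Real.quadratic_le_exp_of_nonneg (by linarith)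
  have hsplit : Real.exp a = Real.exp 4 * Real.exp (a - 4) := by rw [← Real.exp_add]; ring_nf
  have hc : 0 ≤ 1 + (a - 4) + (a - 4) ^ 2 / 2 := by have := sq_nonneg (a - 4); linarith
  have hprod : 54 * (1 + (a - 4) + (a - 4) ^ 2 / 2) ≤ Real.exp a := by
    rw [hsplit]; exact mul_le_mul h4 hquad hc (Real.exp_pos 4).le
  have hu : 0 ≤ a - 4 := by linarith
  constructor
  · nlinarith [sq_nonneg (a - 4), hu, hprod]
  · nlinarith [sq_nonneg (a - 4), hu, hprod]

/-- Arithmetic of the lower bound (pure real inequality). -/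
theorem aux_lower {E x δ a : ℝ} (hδ0 : 0 ≤ δ)
    (hδE_le : δ * E ≤ 1 + δ) (hδE_ge : (1 + δ) * (1 - x) ≤ δ * E) (hEx : E * x = 2 * a * (δ * E))
    (hax : a * x ≤ 69 / 100) (haδ : a * δ ≤ 875 / 10000) (ha : 4 ≤ a) :
    (E + 2 * a - 4) * (1 + δ) ^ 2 ≤ E * (1 + x) := by
  -- `E(1+x) = E + 2a·δE ≥ E + 2a(1+δ)(1−x)`; `(E + 2a − 4)(1+δ)² = E + 2δE + δ²E + (2a−4)(1+δ)²`
  have h1 : E * (1 + x) = E + 2 * a * (δ * E) := by rw [mul_add, mul_one, hEx]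
  have h2 : 2 * a * ((1 + δ) * (1 - x)) ≤ 2 * a * (δ * E) := mul_le_mul_of_nonneg_left hδE_ge (by linarith)
  have h3 : δ ^ 2 * E ≤ δ * (1 + δ) := by nlinarith
  nlinarith [h1, h2, h3, hδE_le, hax, haδ, sq_nonneg δ]

/-- **Sharp lower bound for the PNT-kernel eigenvalue**: for `κ > ½` with `κ sinh κa = cosh(κa)/2` and `a ≥ 4`,
`e^a + 2a − 4 ≤ 1/(κ² − ¼)`. -/
theorem exp_add_two_mul_sub_le_inv_kappa_sq {κ : ℝ} (ha : 4 ≤ a) (hκ : 1 / 2 < κ)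
    (heig : κ * Real.sinh (κ * a) = Real.cosh (κ * a) / 2) :
    Real.exp a + 2 * a - 4 ≤ 1 / (κ ^ 2 - 1 / 4) := by
  rw [inv_kappa_sq_sub_quarter_eq hκ heig]
  have h := kappa_sub_half_eq heig
  set δ := κ - 1 / 2 with hδ
  set q := Real.exp (-(2 * (κ * a))) with hq
  have hδpos : 0 < δ := by rw [hδ]; linarith
  have hk : κ + 1 / 2 = 1 + δ := by rw [hδ]; ring
  rw [hk] at h ⊢
  have ha0 : 0 < a := by linarith
  have hqa : q ≤ Real.exp (-a) := Real.exp_le_exp.2 (by nlinarith)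
  have hea : Real.exp (-a) ≤ Real.exp (-2) := Real.exp_le_exp.2 (by linarith)
  have he2 : Real.exp (-2) ≤ 1354 / 10000 := by
    have : Real.exp (-2) = Real.exp (-1) ^ 2 := by rw [← Real.exp_nat_mul]; norm_num
    rw [this]; nlinarith [Real.exp_neg_one_lt_d9, Real.exp_pos (-1 : ℝ)]
  have hq0 : 0 < q := Real.exp_pos _
  have hδq : δ ≤ (1157 / 1000) * q := by nlinarith
  set x := 2 * δ * a with hx
  have hx0 : 0 ≤ x := by positivity
  have hEpos : 0 < Real.exp a := Real.exp_pos a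
  have hEinv : Real.exp a * Real.exp (-a) = 1 := by rw [← Real.exp_add]; simp
  have hsplit : Real.exp (2 * (κ * a)) = Real.exp a * Real.exp x := by
    rw [← Real.exp_add]; congr 1; rw [hx, hδ]; ring
  have hqE : q * (Real.exp a * Real.exp x) = 1 := by
    rw [← hsplit, hq, ← Real.exp_add]; simp
  have hkey : δ * Real.exp a = (1 + δ) * Real.exp (-x) := by
    have hEx : Real.exp x * Real.exp (-x) = 1 := by rw [← Real.exp_add]; simp
    calc δ * Real.exp a = (1 + δ) * q * Real.exp a := by rw [← h]
      _ = (1 + δ) * q * Real.exp a * (Real.exp x * Real.exp (-x)) := by rw [hEx, mul_one]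
      _ = (1 + δ) * (q * (Real.exp a * Real.exp x)) * Real.exp (-x) := by ring
      _ = (1 + δ) * Real.exp (-x) := by rw [hqE, mul_one]
  -- δ e^a ≤ 1.157: so a·x = 2a²δ ≤ 2.314 a² e^{−a} ≤ 0.68 and aδ ≤ 1.157 a e^{−a} ≤ 0.085
  have hδE1 : Real.exp a * δ ≤ 1157 / 1000 := by
    have h1 : Real.exp a * δ ≤ Real.exp a * ((1157 / 1000) * q) := mul_le_mul_of_nonneg_left hδq hEpos.le
    have h2 : Real.exp a * q ≤ Real.exp a * Real.exp (-a) := mul_le_mul_of_nonneg_left hqa hEpos.le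
    rw [hEinv] at h2
    nlinarith
  obtain ⟨hp1, hp2⟩ := poly_le_exp_four ha
  have hax : a * x ≤ 69 / 100 := by
    have : a * x * Real.exp a ≤ 69 / 100 * Real.exp a := by
      calc a * x * Real.exp a = 2 * a ^ 2 * (Real.exp a * δ) := by rw [hx]; ring
        _ ≤ 2 * a ^ 2 * (1157 / 1000) := mul_le_mul_of_nonneg_left hδE1 (by positivity)
        _ = 2314 / 1000 * a ^ 2 := by ring
        _ ≤ 69 / 100 * Real.exp a := hp1
    exact le_of_mul_le_mul_right this hEpos
  have haδ : a * δ ≤ 875 / 10000 := by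
    have : a * δ * Real.exp a ≤ 875 / 10000 * Real.exp a := by
      calc a * δ * Real.exp a = a * (Real.exp a * δ) := by ring
        _ ≤ a * (1157 / 1000) := mul_le_mul_of_nonneg_left hδE1 ha0.le
        _ ≤ 463 / 100 * a / 4 := by linarith
        _ ≤ 35 / 100 * Real.exp a / 4 := by linarith [hp2]
        _ = 875 / 10000 * Real.exp a := by ring
    exact le_of_mul_le_mul_right this hEpos
  have hexp : 1 + x ≤ Real.exp x := by linarith [Real.add_one_le_exp x]
  have hexpneg : 1 - x ≤ Real.exp (-x) := by have := Real.add_one_le_exp (-x); linarith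
  have hδE_le : δ * Real.exp a ≤ 1 + δ := by
    rw [hkey]
    have : Real.exp (-x) ≤ 1 := by rw [Real.exp_le_one_iff]; linarith
    nlinarith
  have hδE_ge : (1 + δ) * (1 - x) ≤ δ * Real.exp a := by
    rw [hkey]; exact mul_le_mul_of_nonneg_left hexpneg (by linarith)
  have hEx : Real.exp a * x = 2 * a * (δ * Real.exp a) := by rw [hx]; ring
  rw [hsplit, le_div_iff₀ (by positivity)]
  calc (Real.exp a + 2 * a - 4) * (1 + δ) ^ 2 ≤ Real.exp a * (1 + x) :=
        aux_lower hδpos.le hδE_le hδE_ge hEx hax haδ ha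
    _ ≤ Real.exp a * Real.exp x := mul_le_mul_of_nonneg_left hexp hEpos.le

/-- **`e^a + 2a − 4 ≤ pntFloor a` for `a ≥ 4`**: with `pntFloor_le_exp_add_two_mul`, `L(a) = e^a + 2a + O(1)` two-sided in the kernel. -/
theorem exp_add_two_mul_sub_le_pntFloor (ha : 4 ≤ a) : Real.exp a + 2 * a - 4 ≤ pntFloor a := by
  obtain ⟨hκ, heig⟩ := sInf_pntKappaSet_spec (by linarith : 0 < a)
  unfold pntFloor pntKappa
  exact exp_add_two_mul_sub_le_inv_kappa_sq ha hκ heig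

end FloorGrowth

end Summit.RiemannHypothesis.RiemannHypothesis.Theorems.WeilFormatC
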